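import Summits.AnomalousDissipation.AnomalousDissipation.Theorems.TwoAndHalfDScalarLift2halfDRGalerkinSection
import Summits.AnomalousDissipation.AnomalousDissipation.Theorems.TwoAndHalfDScalarLift2halfDRLHCongr
import Summits.AnomalousDissipation.AnomalousDissipation.Theorems.TwoAndHalfDScalarLift2halfDRScalarDescent
import Literature.Analysis.FluidPDE.NSHopfInvariant

/-!
# Route TwoAndHalfD (AnomalousDissipation) — the engine of `ScalarLift2halfDR`: a 2½-D
# Leray–Hopf lift over a GIVEN planar Leray–Hopf velocity (support of item `ScalarLift2halfDR`,
# stmt-AnomalousDissipation-14983)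

Helper file (everything proved). `exists_scalar_lift_isGlobalLerayHopf`: for `ν > 0`, smooth `g`,
`h` on `T²`, `a ∈ L²(T²)` weakly divergence free, `b ∈ L²(T²)`, and a global Leray–Hopf solution
`v` of the planar Navier–Stokes system with steady force `g` from the datum `a` with `v 0 = a`,
there is a scalar `Θ` with `Θ 0 = b` such that `t ↦ (v t, Θ t)∘π` is a global Leray–Hopf solution
on `T³` with force `(g, h)∘π` from `(a, b)∘π`, and `Θ` is a global weak solution of the sourced
scalar equation `∂ₜΘ + v·∇Θ = νΔΘ + h` from `b`.

Construction (no new PDE theory — all tree inputs are proved): the `x₃`-invariant Hopf–Galerkin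
scheme from `(a, b)∘π` (`Literature.Analysis.FluidPDE.exists_isHopfGalerkinScheme_invariant`) has
an everywhere-invariant limit field `u = (V, Θ)∘π`
(`IsHopfGalerkinScheme.exists_invariant_limitField`), Leray–Hopf on every horizon
(`IsHopfGalerkinScheme.isLerayHopfOn_limit`); the planar sections of the scheme form a planar
Hopf–Galerkin scheme with limit field `V` (`isHopfGalerkinScheme_planar`, `limitField_planar`), so
`V` is Leray–Hopf on `T²` and `V t = v t` a.e. for every `t > 0` by Lions–Prodi uniqueness
(`lions_prodi_uniqueness_torus2_holds`); the Leray–Hopf structure passes to `(v, Θ)∘π`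
(`lerayHopfOn_congr_slices`) and the scalar equation descends
(`isWeakScalarTransportForcedOn_of_twoHalf`).

References: Hopf 1951; Robinson–Rodrigo–Sadowski 2016, Thm. 4.4, Def. 4.9; Foias–Manley–Rosa–Temam
2001, Ch. II Thm. 7.3 (Lions–Prodi); Majda–Bertozzi 2002, §2.3.1; Bruè–De Lellis 2023, §3.
-/

noncomputable section

open MeasureTheory Set Filter Topology Function UnitAddTorus
open scoped ENNReal NNReal InnerProductSpace
open Literature.Analysis.FunctionSpaces Literature.Analysis.FunctionSpaces.Torus
open Literature.Analysis.FluidPDE Literature.Analysis.FluidPDE.Torus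

namespace Summit.AnomalousDissipation.AnomalousDissipation.Theorems

-- D-0017: single-problem summit ⇒ `Summit.AnomalousDissipation.AnomalousDissipation.…` by design.
set_option linter.dupNamespace false

/-! ## H4: the engine — a scalar lift over a GIVEN planar Leray–Hopf velocity -/

section Engine

/-- **The 2½-D Leray–Hopf lift over a given planar Leray–Hopf velocity.** Let `ν > 0`, `g`, `h`
smooth on `T²`, `a ∈ L²(T²)` weakly divergence free, `b ∈ L²(T²)`, and let `v` be a global
Leray–Hopf solution of the planar Navier–Stokes system with steady force `g` from the datum `a`,
with `v 0 = a`. Then there is a scalar `Θ` with `Θ 0 = b` such that the lift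
`t ↦ (v t, Θ t)∘π` is a global Leray–Hopf solution on `T³` with force `(g, h)∘π` from
`(a, b)∘π`, and `Θ` is a global weak solution of `∂ₜΘ + v·∇Θ = νΔΘ + h` from `b`.
Construction: the `x₃`-invariant Hopf–Galerkin scheme from `(a,b)∘π`
(`exists_isHopfGalerkinScheme_invariant`) has an invariant Leray–Hopf limit `u = (V, Θ)∘π`
(`exists_invariant_limitField`, `isLerayHopfOn_limit`); its planar sections form a planar scheme
(`isHopfGalerkinScheme_planar`) with limit field `V` (`limitField_planar`), so `V` is Leray–Hopf on
`T²` and equals `v` at every positive time by two-dimensional uniqueness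
(`lions_prodi_uniqueness_torus2_holds`); the Leray–Hopf structure passes to `(v, Θ)∘π`
(`lerayHopfOn_congr_slices`) and the scalar equation descends
(`isWeakScalarTransportForcedOn_of_twoHalf`). [folklore] -/
theorem exists_scalar_lift_isGlobalLerayHopf {ν : ℝ} (hν : 0 < ν)
    {g : UnitAddTorus (Fin 2) → EuclideanSpace ℝ (Fin 2)} (hg : IsSmooth g)
    {h : UnitAddTorus (Fin 2) → ℝ} (hh : IsSmooth h)
    {a : UnitAddTorus (Fin 2) → EuclideanSpace ℝ (Fin 2)} (ha : MemLp a 2 volume) (hadiv : IsWeaklyDivFree a)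
    {b : UnitAddTorus (Fin 2) → ℝ} (hb : MemLp b 2 volume)
    {v : ℝ → UnitAddTorus (Fin 2) → EuclideanSpace ℝ (Fin 2)}
    (hv : IsGlobalLerayHopf ν (fun _ => g) a v) (hv0 : v 0 = a) :
    ∃ Θ : ℝ → UnitAddTorus (Fin 2) → ℝ, Θ 0 = b ∧
      IsGlobalLerayHopf ν (fun _ => twoHalf g h) (twoHalf a b) (fun t => twoHalf (v t) (Θ t)) ∧
      IsWeakScalarTransportForced ν v (fun _ => h) b Θ := by
  -- ### the three-dimensional data
  have hu₀ : MemLp (twoHalf a b) 2 volume := memLp_twoHalf one_le_two ha hb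
  have hu₀div : IsWeaklyDivFree (twoHalf a b) := isWeaklyDivFree_twoHalf ha hb hadiv
  have hu₀inv : ∀ (s : UnitAddCircle) (x : UnitAddTorus (Fin 3)),
      twoHalf a b (x + Pi.single (Fin.last 2) s) = twoHalf a b x := twoHalf_add_single a b
  have hfs : IsSmooth (twoHalf g h) := hg.twoHalf hh
  have hfm : AEStronglyMeasurable (stLift (fun _ : ℝ => twoHalf g h)) (volume.restrict (Ioi 0 ×ˢ univ)) :=
    aestronglyMeasurable_stLift_const hfs _
  have hf2 : ∀ T : ℝ, 0 < T → ∫⁻ _ in Ioo 0 T, ∫⁻ x, ‖twoHalf g h x‖ₑ ^ 2 < ⊤ := fun T _ =>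
    lintegral_enorm_sq_const_lt_top hfs T
  have hfinv : ∀ (t : ℝ) (s : UnitAddCircle) (x : UnitAddTorus (Fin 3)),
      (fun _ : ℝ => twoHalf g h) t (x + Pi.single (Fin.last 2) s) = (fun _ : ℝ => twoHalf g h) t x :=
    fun _ => twoHalf_add_single g h
  have hgm : AEStronglyMeasurable (stLift (fun _ : ℝ => g)) (volume.restrict (Ioi 0 ×ˢ univ)) :=
    aestronglyMeasurable_stLift_const hg _
  have hg2 : ∀ T : ℝ, 0 < T → ∫⁻ _ in Ioo 0 T, ∫⁻ x, ‖g x‖ₑ ^ 2 < ⊤ := fun T _ => lintegral_enorm_sq_const_lt_top hg T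
  -- ### the invariant scheme and its invariant limit
  obtain ⟨N, F, U, hS, hUinv, hFinv⟩ := exists_isHopfGalerkinScheme_invariant ν hν (twoHalf a b) hu₀ hu₀div
    (fun _ => twoHalf g h) hfm hf2 (Fin.last 2) hu₀inv hfinv
  obtain ⟨φ, hφ, u, hum, hu, hc, huinv⟩ := hS.exists_invariant_limitField hν.le hu₀ hfm hf2 (i := Fin.last 2)
    (fun n t _ => hUinv n t)
  have hS' := hS.comp_strictMono hφ
  have hLH3 : IsGlobalLerayHopf ν (fun _ => twoHalf g h) (twoHalf a b) u := fun T hT =>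
    hS'.isLerayHopfOn_limit hν hu₀ hu₀div hfm hf2 hum hu hc hT
  -- ### the planar section is Leray–Hopf on `T²`, hence equal to `v`
  set V : ℝ → UnitAddTorus (Fin 2) → EuclideanSpace ℝ (Fin 2) := fun t y => planarProjE (u t (planarSect y)) with hVdef
  set Θ' : ℝ → UnitAddTorus (Fin 2) → ℝ := fun t y => u t (planarSect y) 2 with hΘ'def
  have hueq : ∀ t, u t = twoHalf (V t) (Θ' t) := fun t => eq_twoHalf_of_forall_add_single (huinv t)
  have hS2 := isHopfGalerkinScheme_planar hS' (fun n t => hUinv (φ n) t) (fun n t => hFinv (φ n) t) ha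
  obtain ⟨hum2, hu2, hc2⟩ := limitField_planar (U := U ∘ φ) (fun n t => hUinv (φ n) t) huinv
    (fun n t ht => hS'.continuous_slice n ht) hum hu hc
  have hLH2 : IsGlobalLerayHopf ν (fun _ => g) a V := fun T hT =>
    hS2.isLerayHopfOn_limit hν ha hadiv hgm hg2 hum2 hu2 hc2 hT
  have hVv : ∀ t, 0 < t → V t =ᵐ[volume] v t := fun t ht =>
    lions_prodi_uniqueness_torus2_holds.global hν hgm hg2 ha hadiv hLH2 hv ht
  have hu0 : u 0 =ᵐ[volume] twoHalf a b := hS'.limit_zero_ae_eq hu₀ hu₀div hu hc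
  -- ### the scalar, with the honest value `b` at `t = 0`
  set Θ : ℝ → UnitAddTorus (Fin 2) → ℝ := fun t => if t = 0 then b else Θ' t with hΘdef
  have hΘ0 : Θ 0 = b := by simp [hΘdef]
  have hΘpos : ∀ t, 0 < t → Θ t = Θ' t := fun t ht => by simp [hΘdef, ht.ne']
  -- the new lift agrees with `u` slice by slice, a.e.
  have hae : ∀ t, 0 ≤ t → (twoHalf (v t) (Θ t)) =ᵐ[volume] u t := by
    intro t ht
    rcases eq_or_lt_of_le ht with rfl | ht'
    · rw [hv0, hΘ0]
      exact hu0.symm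
    · rw [hΘpos t ht', hueq t]
      have h1 := measurePreserving_planarProj.quasiMeasurePreserving.ae_eq_comp (hVv t ht').symm
      filter_upwards [h1] with x hx
      simp only [Function.comp_apply] at hx
      simp only [twoHalf, hx]
  -- measurability of the new lift on `(0, T) × ℝ³`
  have hmeas : ∀ T, 0 < T → AEStronglyMeasurable (stLift fun t => twoHalf (v t) (Θ t))
      (volume.restrict (Ioo 0 T ×ˢ univ)) := by
    intro T hT
    have humT : AEStronglyMeasurable (stLift u) (volume.restrict (Ioo 0 T ×ˢ univ)) :=
      hum.mono_measure (Measure.restrict_mono (prod_mono Ioo_subset_Ioi_self subset_rfl) le_rfl)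
    have hufun : u = fun t => twoHalf (V t) (Θ' t) := funext hueq
    rw [hufun] at humT
    have hΘ'm := (aestronglyMeasurable_stLift_of_twoHalf humT).2
    have hvm := (hv T hT).weak.1
    have h1 : AEStronglyMeasurable (stLift fun t => twoHalf (v t) (Θ' t)) (volume.restrict (Ioo 0 T ×ˢ univ)) := by
      have hvu := aestronglyMeasurable_uncurry_of_stLift_prod hvm
      have hΘu := aestronglyMeasurable_uncurry_of_stLift_prod hΘ'm
      exact aestronglyMeasurable_stLift_of_uncurry (aestronglyMeasurable_uncurry_twoHalf hvu hΘu)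
    refine h1.congr ?_
    filter_upwards [ae_restrict_mem (measurableSet_Ioo.prod MeasurableSet.univ)] with p hp
    simp only [stLift, hΘpos p.1 hp.1.1]
  have hLH : IsGlobalLerayHopf ν (fun _ => twoHalf g h) (twoHalf a b) (fun t => twoHalf (v t) (Θ t)) := fun T hT =>
    lerayHopfOn_congr_slices (hLH3 T hT) hT (fun t ht => hae t ht.1) (hmeas T hT)
  refine ⟨Θ, hΘ0, hLH, fun T hT => ?_⟩
  exact isWeakScalarTransportForcedOn_of_twoHalf (hLH T hT).weak (hLH T hT).energy_bound hh hb

end Engine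

end Summit.AnomalousDissipation.AnomalousDissipation.Theorems

end
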